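import Summits.RiemannHypothesis.RiemannHypothesis.Theorems.TiltedLandingLaw421R3RateGlue2A

/-!
# TiltedLandingLaw421R3FLink — the F-LINK of the C3 count line, v4d = BOX-BINDERED LAWS + per-level SEAM (curried transport) + PLUMBED twin (W-09 C3 «analysis», rh-idea-3 g52; (CA832)(4), (CA836)(1), (CA843)(2))

LANDING IMAGE v4.  Namespace `RhW08.FLink`; ONE tree import (`…R3RateGlue2A`, which carries `…R3RateSkeletonB` = T-MOD′ `FarFieldModulusLawA'`,
`farFieldAt`, `levelField` and the W-08 kernel); no `sorry`, no new axioms, no instances / notation.  (T) = typed statement (OPEN unless marked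
consistent), (K) = kernel-checked.

WHY v4 (what the certified benches decided).  instr-1 E15-ENTRANT + crit-1 CAND-10 (dossier `crit-g7/cand10/CAND10.md` 77b4ade0, frame X3 =
`f = e^{−9z/20}(z²+(47/25)²)((z−10)²+(3/5)²)·Π_{k<150}(z−16−k/20)`, `x₀ 0, s 1/20, hmax 39/20, R 6, Hs 19/10, B 119`, all 16 `EngineHyps5 2` clauses
certified, `WindowReady` ABSENT through level 35): a pair parked OUTSIDE the frame's column enters the widening band `StColQ'`, becomes the band-lowest
state on charged far levels `j = 20…51`, and there the registry's F1 `RhW08.SealSwapQ.FarEnergyLawCQ (4/5)` FAILS as typed (ratio `.43–.68`,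
«CANDIDATE NEG 10», (CA832)) and so does T-MOD′ (`‖farFieldAt‖ = 1.655–1.658·η/s > 1.118·η/s`).  C3's own evaluation of the v3 laws on the same
certified rows (`pub/ideators/rh-idea-3/g52/x3/flx3.py` 8a23b556, table `flx3-out.txt` 272a40c7; NOTE-5): v3 §2′ `LineRemainderSig` FAILS AS TYPED
on all 33 entrant-lowest rows (`1.638–1.645·η/s > η/s` — its line point `p₀` sits at `Re ≈ 11–13`, outside the `RemainderBox` column `|Re − x₀| ≤ 3`,
and sees the real block exactly as T-MOD′ does), while v3 §3 `FLinkSig' θ` HOLDS AS TYPED at `θ = .118` (lateral gain `+.013…+.017·η/s`).  Director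
(CA832)(3): the retype direction of record is crit-1's ONE-BINDER BOX `C′` — the lowest state lies in the frame's box, `|Re v − x₀| ≤ R/2 ∧ Im v ≤ hmax`
— under which every X3 row is out of scope and the line point `p₀ = Re v + i·Im w` lies in the `RemainderBox` box at EVERY level.

WHAT CHANGED FROM v4b (44393558, keyed RSV-76 (CA843)): §6's ∀-law `RemainderBoxHereditySig` + `lineRemainderBox_of_heredity` are replaced by the seam
predicate + the CURRIED transport (same proof) and the plumbed twin §7 is added; §1–§5 are v4b VERBATIM.  WHAT CHANGED FROM v3 (a7fb4b5d) / v3c (3aec0942): (i) §2′ is now stated ONLY box-bindered (`LineRemainderBoxSig`; the unrestricted `LineRemainderSig`,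
candidate-false as typed, is withdrawn — its level-0 instance survives as the explicit theorem `lineRemainder_zero`); (ii) §3 `FLinkSig' θ` is KEPT
unrestricted (it held on X3) and gets its box-bindered twin `FLinkBoxSig' θ` (unrestricted ⇒ boxed, `fLinkBox_of_fLink`); (iii) the modulus law the two
feed is the BOX-RESTRICTED T-MOD′ `FarFieldModulusLawBox lam` (the tree's `FarFieldModulusLawA'` binders + the box binder) with the sink
`TModAllowanceBoxSig := ∃ λ, 0 < λ ∧ λ² ≤ 5/4 ∧ FarFieldModulusLawBox λ`; (iv) v3's §4 kernels to the UNRESTRICTED T-MOD′ / F1 / `TiltedLandingLaw421`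
are withdrawn with their targets (F1 is CANDIDATE-DEAD as typed); the F1-side of the box retype (`FarEnergyLawCBoxQ`, the excluded-level cap and the new
books glue) is C4's image 120 v3 «F1Box» per (CA832)(3) — THE CONSUMER GAP IS STATED, NOT HIDDEN: this file ends at `TModAllowanceBoxSig`; nothing here
reaches `TiltedLandingLaw421` by name until that glue exists.  Names: the v3c «Col» statements are renamed «Box» and carry the extra height binder
`v.im ≤ hmax` (C′ verbatim); nothing else moved.

CONTENT.
* §1 ★ `WindowedCountSig` — the WINDOWED COUNT HEREDITY (C3 g42 v4 with crit-1 CUT 45's per-level guard `iteratedDeriv (k+1) f ≠ 0` inside the `∀ k`);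
  KEY as typed (crit-1 CUT 45/45b).
* §2 the LINE POINT `linePt v w := Re v + i·Im w` and ★★ §3 `FLinkSig' θ` — the LATERAL GAIN LAW (T-MOD′'s binders verbatim): at the moving child,
  `‖farFieldAt f j v w‖` exceeds the line remainder at `p₀` by at most `θ·η/s`.  A second-moment statement about the far configuration seen from the
  pair's axis; benches: `θ_obs ≤ .03` (B-a), `≤ .017` on X3's entrant rows; allowance `θ ≤ √(5/4) − 1 ≈ .118`.  ★ is what is conjectured to PROVE it.
* §4 (K) `lineRemainder_zero` — the LEVEL-0 CONSISTENCY LEMMA: on every legal frame the `j = 0` line remainder bound follows from `EngineHyps5 2 …` alone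
  (its `RemainderBox` at `p₀`, the seed `init0Sig_stTrkDQ` for `Im v ≤ hmax`, isolation for `f p₀ ≠ 0`).
* §5 the BOX-BINDERED LAWS (binder `|v.re − x₀| ≤ R/2 → v.im ≤ hmax →` right after `IsLowest …`): §2′ `LineRemainderBoxSig` (T, OPEN at `j ≥ 1`,
  consistent at `j = 0` by `lineRemainderBoxSig_zero`), §3′ `FLinkBoxSig' θ` (T, OPEN), `FarFieldModulusLawBox lam` (T, OPEN), the sink
  `TModAllowanceBoxSig` (T), and the kernels (K) `fLinkBox_of_fLink`, `farFieldModulusLawBox_of_fLinkBox` (§2′ ∧ §3′(θ) ⇒ the box modulus law at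
  `λ = 1+θ`, a two-line triangle), `tModAllowanceBox_of_fLinkBox` (`0 ≤ θ`, `(1+θ)² ≤ 5/4`), `farFieldModulusLawBox_of_lawA'` (T-MOD′ ⇒ box form,
  bookkeeping), `abs_linePt_re_sub_le` (the line point stays in the column).
* §6 the SEAM and the TRANSPORT ((CA836)(1) «name the level-j transport lemma»; (CA843)(2) direction (i)): the hypothesis-only seam predicate
  `LevelRemainderBox η f x₀ s hmax R j := RemainderBox η (iteratedDeriv j f) x₀ s hmax R` (clause 16 read for `f⁽ʲ⁾`; `levelRemainderBox_zero`) and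
  (K, PROVED) ★ `lineRemainderAt_of_levelRemainderBox` — at one (frame, level): seam + C′ binder ⇒ the level-`j` line remainder bound at `p₀` (the level-0
  argument verbatim with `f ↦ f⁽ʲ⁾`; HEIGHT half of C′ feeds `hp2`, COLUMN half `hp1`).  So §2′ at a level IS the seam read at the line point; v4b's ∀-law
  `RemainderBoxHereditySig` is WITHDRAWN (probable infall / tight-edge failure at levels or points carrying no lowest state — see §6's docstring).
* §7 the PLUMBED twin: `FarFieldModulusLawBoxPl lam` (T-MOD′'s binders + C′ + the seam as ONE hypothesis), sink `TModAllowanceBoxPlSig`, and (K, PROVED)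
  ★ `farFieldModulusLawBoxPl_of_fLinkBox : FLinkBoxSig' θ → FarFieldModulusLawBoxPl (1+θ)` (THE GAIN LAW ALONE GIVES THE PLUMBED SINK),
  `tModAllowanceBoxPl_of_fLinkBox` / `tModAllowanceBoxPl_of_fLink`, `farFieldModulusLawBoxPl_of_lawBox` / `…_of_lawA'` (bookkeeping).
  OPEN CONTENT OF THE F-LINK: §2′ (= the seam at line points of charged far levels whose lowest state is in the box) and the gain law §3/§3′ (★ behind both).

Nothing here bears on the truth of RH.  ★, §2′ (levels ≥ 1), §3, §3′, the box modulus law and every books law remain typed OPEN; the seam is a hypothesis; a certified float /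
exact-polynomial row is not a Lean refutation.  Checked ≠ landed ≠ proved.
-/

noncomputable section

namespace RhW08.FLink

open Complex Metric
open scoped ComplexConjugate
open RhW08.Round1 RhW08.StSwap RhW08.Round2 RhW08.QuadW
open RhW08.SealSwap (PBot)
open RhW08.SealSwapQ RhW08.RateSplit RhW08.IsolatedTilt RhW08.FarStep RhW08.BurgersRate RhW08.PurseP RhW08.BurgersRateG3
open RhIdea6.G17.W07C7 RhIdea6.G17.W07C7.Rev6 RhIdea6.G18.W07C8.Law421BirthS RhIdea6.G19.W07C11.Seam
open RhIdea6.G20.W07C12.Frac RhIdea6.G20.W07C12.StColP RhW07.C12.FieldSplit RhIdea6.G21.W07C13.TentMax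
open RhW07.C14.TwoSided RhW07.C14.Classes RhW07.C14.Lineage RhW07.C14.Booking

/-! ## §1 ★ the WINDOWED COUNT heredity (C3 g42 v4, with crit-1 CUT 45's per-level guard) -/

/-- ★ (T, OPEN) **WINDOWED COUNT HEREDITY**: for `f` entire of order `< 2`, real on `ℝ`, zeros in the strip `|Im| ≤ Δ`, and every level `k` with
`f⁽ᵏ⁺¹⁾ ≢ 0`: the zeros of `f⁽ᵏ⁺¹⁾` in a lateral window `|Re − x| ≤ D` number at most those of `f⁽ᵏ⁾` in the `Δ`-widened window, plus one.
(v2's global guard `∀ n, f⁽ⁿ⁾ ≢ 0` made per-level, crit-1 CUT 45 (A).) -/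
def WindowedCountSig : Prop :=
  ∀ ⦃f : ℂ → ℂ⦄ ⦃C ρ Δ : ℝ⦄, Differentiable ℂ f → 0 ≤ ρ → ρ < 2 → (∀ z, ‖f z‖ ≤ C * Real.exp (‖z‖ ^ ρ)) →
    (∀ x : ℝ, (f x).im = 0) → 0 ≤ Δ → (∀ z, f z = 0 → |z.im| ≤ Δ) →
    ∀ (k : ℕ) (x D : ℝ), iteratedDeriv (k + 1) f ≠ 0 → 0 ≤ D →
      ∑ᶠ w ∈ {w : ℂ | |w.re - x| ≤ D}, analyticOrderNatAt (iteratedDeriv (k + 1) f) w ≤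
        ∑ᶠ a ∈ {a : ℂ | |a.re - x| ≤ D + Δ}, analyticOrderNatAt (iteratedDeriv k f) a + 1

/-! ## §2 the LINE POINT `p₀ = Re v + i·Im w` (recipe ρ1: the remainder is read on the pair's axis at the child's height) -/

/-- the LINE POINT of the pair's axis at the child's height: `p₀ := Re v + i·Im w`. -/
def linePt (v w : ℂ) : ℂ := ⟨v.re, w.im⟩

/-- (K) the line point has the pair's abscissa. -/
theorem linePt_re (v w : ℂ) : (linePt v w).re = v.re := rfl

/-- (K) the line point has the child's height. -/
theorem linePt_im (v w : ℂ) : (linePt v w).im = w.im := rfl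

/-! ## §3 ★★ THE F-LINK: the LATERAL GAIN LAW (the statement ★ is to prove; T-MOD′'s binders verbatim; held on X3) -/

/-- ★★ §3 (T, OPEN) **THE F-LINK BRIDGE STATEMENT — LATERAL GAIN LAW** `FLinkSig' θ`: on a legal frame, at a charged far level with lowest state `v` and
moving child `w` (T-MOD′'s binders verbatim), the far cofactor field at the child exceeds the line remainder at `p₀ = Re v + i·Im w` by at most `θ·η/s`:
`‖farFieldAt f j v w‖ ≤ ‖φ_j(p₀) − Σ_{|Re u − Re v| < R/2} m_u/(p₀ − u)‖ + θ·η/s`.  A second-moment statement about the far configuration seen from the pair's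
axis over the lateral displacement `|Re w − Re v| ≤ |Im v|`; bench B-a: `θ_obs ≤ 0.03` on charged rows (allowance `θ ≤ √(5/4) − 1 ≈ 0.118`). -/
def FLinkSig' (θ : ℝ) : Prop :=
  ∀ (η : ℝ) (f : ℂ → ℂ) (x₀ s hmax R Hs : ℝ) (B : ℕ), EngineHyps5 2 η f x₀ s hmax R Hs B →
    ∀ (j : ℕ) (v w : ℂ), FarLevelQ η f x₀ s hmax R Hs B j → Charged (PTrkSQ PBot) StTrkDQ ReadyR2 η f x₀ s hmax R Hs B j →
      IsLowest StTrkDQ η f x₀ s hmax R Hs B j v → iteratedDeriv j f w ≠ 0 →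
      (∀ z : ℂ, iteratedDeriv j f z = 0 → |z.re - v.re| < R / 2 → z = v ∨ z = conj v) →
      iteratedDeriv (j + 1) f w = 0 → 0 < w.im → ‖w - (v.re : ℂ)‖ ≤ |v.im| →
        ‖farFieldAt f j v w‖ ≤
          ‖levelField f j (linePt v w)
              - ∑ᶠ u ∈ {u : ℂ | iteratedDeriv j f u = 0 ∧ |u.re - v.re| < R / 2},
                  ((analyticOrderAt (iteratedDeriv j f) u).toNat : ℂ) * (linePt v w - u)⁻¹‖ + θ * η / s

/-! ## §4 (K) the LEVEL-0 CONSISTENCY LEMMA (crit-1 CUT 45's vacuity guard): `EngineHyps5 2 …` ⇒ the line remainder bound at `j = 0` -/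

/-- (K) on a legal frame, a lowest level-`0` band state has height `≤ hmax` (the seed `init0Sig_stTrkDQ` is a level-`0` state of height `≤ hmax`). -/
theorem im_le_hmax_of_isLowest_zero {η : ℝ} {f : ℂ → ℂ} {x₀ s hmax R Hs : ℝ} {B : ℕ} (hE : EngineHyps5 2 η f x₀ s hmax R Hs B) {v : ℂ}
    (hlow : IsLowest StTrkDQ η f x₀ s hmax R Hs B 0 v) : v.im ≤ hmax := by
  obtain ⟨u, hu, huh⟩ := init0Sig_stTrkDQ η f x₀ s hmax R Hs B hE
  exact (hlow.2 u hu).trans ((le_abs_self _).trans huh)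

/-- (K) a level-`0` band state lies in the frame's column `|Re v − x₀| ≤ R/2` (the band at `j = 0`). -/
theorem abs_re_sub_le_of_stTrkDQ_zero {η : ℝ} {f : ℂ → ℂ} {x₀ s hmax R Hs : ℝ} {B : ℕ} {v : ℂ} (hv : StTrkDQ η f x₀ s hmax R Hs B 0 v) :
    |v.re - x₀| ≤ R / 2 := by
  obtain ⟨_, _, _, hq, _⟩ := hv
  have h1 : (max (|v.re - x₀| - R / 2) 0) ^ 2 ≤ 0 := by simpa using hq
  have h2 : max (|v.re - x₀| - R / 2) 0 = 0 := pow_eq_zero_iff (two_ne_zero) |>.mp (le_antisymm h1 (sq_nonneg _))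
  have h3 := le_max_left (|v.re - x₀| - R / 2) 0
  rw [h2] at h3
  linarith

/-- ★ (K) **LEVEL-0 CONSISTENCY**: at level `0`, for a lowest band state `v` with isolated pair and any point `w ≠` zero of `f` of the closed axis-centred disc
with `0 < Im w`, the line point `p₀ = Re v + i·Im w` lies in the `RemainderBox` box, `f p₀ ≠ 0`, and the frame's remainder bound IS the `j = 0` line remainder
bound.  (Uses only `EngineHyps5 2 …`: `RemainderBox`, the seed, `2s ≤ hmax`, `3·hmax < R`.) -/
theorem lineRemainder_zero {η : ℝ} {f : ℂ → ℂ} {x₀ s hmax R Hs : ℝ} {B : ℕ} (hE : EngineHyps5 2 η f x₀ s hmax R Hs B) {v w : ℂ}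
    (hlow : IsLowest StTrkDQ η f x₀ s hmax R Hs B 0 v) (hw0 : iteratedDeriv 0 f w ≠ 0)
    (hiso : ∀ z : ℂ, iteratedDeriv 0 f z = 0 → |z.re - v.re| < R / 2 → z = v ∨ z = conj v) (hwim : 0 < w.im)
    (hdisc : ‖w - (v.re : ℂ)‖ ≤ |v.im|) :
    ‖levelField f 0 (linePt v w)
        - ∑ᶠ u ∈ {u : ℂ | iteratedDeriv 0 f u = 0 ∧ |u.re - v.re| < R / 2},
            ((analyticOrderAt (iteratedDeriv 0 f) u).toNat : ℂ) * (linePt v w - u)⁻¹‖ ≤ η / s := by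
  have hvh : v.im ≤ hmax := im_le_hmax_of_isLowest_zero hE hlow
  have hband : |v.re - x₀| ≤ R / 2 := abs_re_sub_le_of_stTrkDQ_zero hlow.1
  obtain ⟨_, _, _, hs, hsh, _, h3R, _, _, _, _, _, _, _, _, hRB⟩ := hE
  obtain ⟨_, hvz, hvpos, _, _⟩ := hlow.1
  have hR : 0 < R := by linarith
  have hdisc' : ‖w - (v.re : ℂ)‖ ≤ v.im := by rwa [abs_of_pos hvpos] at hdisc
  -- the child's height is at most, and in fact strictly below, the pair's height
  have hwle : w.im ≤ v.im := by
    have h1 : |(w - (v.re : ℂ)).im| ≤ ‖w - (v.re : ℂ)‖ := Complex.abs_im_le_norm _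
    have h2 : (w - (v.re : ℂ)).im = w.im := by simp
    rw [h2, abs_of_pos hwim] at h1
    linarith
  have hwlt : w.im < v.im := by
    rcases lt_or_eq_of_le hwle with h | h
    · exact h
    · exfalso
      have hn : ‖w - (v.re : ℂ)‖ ^ 2 = (w.re - v.re) ^ 2 + w.im ^ 2 := by
        rw [Complex.sq_norm, Complex.normSq_apply]; simp; ring
      have hd2 : ‖w - (v.re : ℂ)‖ ^ 2 ≤ v.im ^ 2 := pow_le_pow_left₀ (norm_nonneg _) hdisc' 2
      have hre : (w.re - v.re) ^ 2 ≤ 0 := by nlinarith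
      have hre0 : w.re - v.re = 0 := pow_eq_zero_iff two_ne_zero |>.mp (le_antisymm hre (sq_nonneg _))
      have hwv : w = v := Complex.ext (by linarith) h
      exact hw0 (by rw [hwv]; exact hvz)
  -- the line point is in the `RemainderBox` box and is not a zero of `f`
  have hp1 : |(linePt v w).re - x₀| ≤ R / 2 := by rw [linePt_re]; exact hband
  have hp2 : |(linePt v w).im| ≤ hmax := by rw [linePt_im, abs_of_pos hwim]; linarith
  have hp3 : f (linePt v w) ≠ 0 := by
    intro hfp
    have hz : iteratedDeriv 0 f (linePt v w) = 0 := by simpa using hfp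
    have hwin : |(linePt v w).re - v.re| < R / 2 := by rw [linePt_re, sub_self, abs_zero]; linarith
    rcases hiso _ hz hwin with h | h
    · have h' : (linePt v w).im = v.im := by rw [h]
      rw [linePt_im] at h'
      linarith
    · have h' : (linePt v w).im = (conj v).im := by rw [h]
      rw [linePt_im, Complex.conj_im] at h'
      linarith
  have key := hRB (linePt v w) hp1 hp2 hp3
  simp only [linePt_re] at key
  simpa only [levelField, zero_add, iteratedDeriv_one, iteratedDeriv_zero] using key

/-! ## §5 the BOX-BINDERED LAWS (crit-1's C′ binder `|Re v − x₀| ≤ R/2 ∧ Im v ≤ hmax`, director (CA832)(3)): §2′, §3′, the box modulus law, the sink, kernels -/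

/-- §2′ (T; OPEN at `j ≥ 1`, CONSISTENT at `j = 0` by `lineRemainderBoxSig_zero`) **LINE REMAINDER LAW, BOX-BINDERED**: on a legal frame, at a CHARGED FAR
level `j` whose lowest state `v` (isolated pair) lies in the frame's BOX (`|Re v − x₀| ≤ R/2`, `Im v ≤ hmax` — crit-1's C′ binder), with moving child `w`
(`f⁽ʲ⁺¹⁾ w = 0`, `f⁽ʲ⁾ w ≠ 0`, `0 < Im w`, `‖w − Re v‖ ≤ |Im v|`), the level field at the line point `p₀ = Re v + i·Im w` minus its polar part over `v`'s
window `|Re u − Re v| < R/2` (= the pair, with multiplicity) has modulus `≤ η/s`.  All other binders = T-MOD′ `RhW08.BurgersRateG3.FarFieldModulusLawA'`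
verbatim.  (v3's unrestricted form failed as typed on crit-1's X3 entrant rows, `1.64·η/s`; every such row violates the box binder.) -/
def LineRemainderBoxSig : Prop :=
  ∀ (η : ℝ) (f : ℂ → ℂ) (x₀ s hmax R Hs : ℝ) (B : ℕ), EngineHyps5 2 η f x₀ s hmax R Hs B →
    ∀ (j : ℕ) (v w : ℂ), FarLevelQ η f x₀ s hmax R Hs B j → Charged (PTrkSQ PBot) StTrkDQ ReadyR2 η f x₀ s hmax R Hs B j →
      IsLowest StTrkDQ η f x₀ s hmax R Hs B j v → |v.re - x₀| ≤ R / 2 → v.im ≤ hmax → iteratedDeriv j f w ≠ 0 →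
      (∀ z : ℂ, iteratedDeriv j f z = 0 → |z.re - v.re| < R / 2 → z = v ∨ z = conj v) →
      iteratedDeriv (j + 1) f w = 0 → 0 < w.im → ‖w - (v.re : ℂ)‖ ≤ |v.im| →
        ‖levelField f j (linePt v w)
            - ∑ᶠ u ∈ {u : ℂ | iteratedDeriv j f u = 0 ∧ |u.re - v.re| < R / 2},
                ((analyticOrderAt (iteratedDeriv j f) u).toNat : ℂ) * (linePt v w - u)⁻¹‖ ≤ η / s

/-- §3′ (T, OPEN) **LATERAL GAIN LAW, BOX-BINDERED** `FLinkBoxSig' θ`: `FLinkSig' θ` with the same box binder (implied by `FLinkSig' θ`, `fLinkBox_of_fLink`). -/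
def FLinkBoxSig' (θ : ℝ) : Prop :=
  ∀ (η : ℝ) (f : ℂ → ℂ) (x₀ s hmax R Hs : ℝ) (B : ℕ), EngineHyps5 2 η f x₀ s hmax R Hs B →
    ∀ (j : ℕ) (v w : ℂ), FarLevelQ η f x₀ s hmax R Hs B j → Charged (PTrkSQ PBot) StTrkDQ ReadyR2 η f x₀ s hmax R Hs B j →
      IsLowest StTrkDQ η f x₀ s hmax R Hs B j v → |v.re - x₀| ≤ R / 2 → v.im ≤ hmax → iteratedDeriv j f w ≠ 0 →
      (∀ z : ℂ, iteratedDeriv j f z = 0 → |z.re - v.re| < R / 2 → z = v ∨ z = conj v) →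
      iteratedDeriv (j + 1) f w = 0 → 0 < w.im → ‖w - (v.re : ℂ)‖ ≤ |v.im| →
        ‖farFieldAt f j v w‖ ≤
          ‖levelField f j (linePt v w)
              - ∑ᶠ u ∈ {u : ℂ | iteratedDeriv j f u = 0 ∧ |u.re - v.re| < R / 2},
                  ((analyticOrderAt (iteratedDeriv j f) u).toNat : ℂ) * (linePt v w - u)⁻¹‖ + θ * η / s

/-- (T, OPEN) **FAR-FIELD MODULUS LAW, BOX-BINDERED** `FarFieldModulusLawBox lam`: the tree's T-MOD′ `FarFieldModulusLawA' lam` with the same box binder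
(the lowest state lies in the frame's box, so entrant-lowest levels — where T-MOD′ failed as typed on X3, `1.66·η/s` — are outside its scope). -/
def FarFieldModulusLawBox (lam : ℝ) : Prop :=
  ∀ (η : ℝ) (f : ℂ → ℂ) (x₀ s hmax R Hs : ℝ) (B : ℕ), EngineHyps5 2 η f x₀ s hmax R Hs B →
    ∀ (j : ℕ) (v w : ℂ), FarLevelQ η f x₀ s hmax R Hs B j → Charged (PTrkSQ PBot) StTrkDQ ReadyR2 η f x₀ s hmax R Hs B j →
      IsLowest StTrkDQ η f x₀ s hmax R Hs B j v → |v.re - x₀| ≤ R / 2 → v.im ≤ hmax → iteratedDeriv j f w ≠ 0 →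
      (∀ z : ℂ, iteratedDeriv j f z = 0 → |z.re - v.re| < R / 2 → z = v ∨ z = conj v) →
      iteratedDeriv (j + 1) f w = 0 → 0 < w.im → ‖w - (v.re : ℂ)‖ ≤ |v.im| → ‖farFieldAt f j v w‖ ≤ lam * η / s

/-- (T) **THE SINK, NAMED**: the box-bindered modulus law holds with SOME multiplier inside the sharp step's allowance `λ² ≤ 5/4`. -/
def TModAllowanceBoxSig : Prop := ∃ lam : ℝ, 0 < lam ∧ lam ^ 2 ≤ 5 / 4 ∧ FarFieldModulusLawBox lam

/-- (K) the tree's T-MOD′ `FarFieldModulusLawA' lam` implies its box-bindered form (drop two binders; recorded for the name list of (CA836)(1) — T-MOD′ itself is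
candidate-dead as typed on X3, so this kernel is bookkeeping, not a route to the sink). -/
theorem farFieldModulusLawBox_of_lawA' (lam : ℝ) (h : FarFieldModulusLawA' lam) : FarFieldModulusLawBox lam :=
  fun η f x₀ s hmax R Hs B hE j v w hfar hch hlow _hcol _hh hw0 hiso hw1 hwim hdisc =>
    h η f x₀ s hmax R Hs B hE j v w hfar hch hlow hw0 hiso hw1 hwim hdisc

/-- (K) the unrestricted gain law implies the box-bindered one (drop two binders). -/
theorem fLinkBox_of_fLink {θ : ℝ} (h : FLinkSig' θ) : FLinkBoxSig' θ :=
  fun η f x₀ s hmax R Hs B hE j v w hfar hch hlow _hcol _hh hw0 hiso hw1 hwim hdisc =>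
    h η f x₀ s hmax R Hs B hE j v w hfar hch hlow hw0 hiso hw1 hwim hdisc

/-- ★ (K) **§2′ ∧ §3′(θ) ⇒ the box-bindered modulus law at `λ = 1 + θ`** (a two-line triangle; no finsum surgery, no simplicity case split). -/
theorem farFieldModulusLawBox_of_fLinkBox {θ : ℝ} (hL : LineRemainderBoxSig) (hG : FLinkBoxSig' θ) : FarFieldModulusLawBox (1 + θ) := by
  intro η f x₀ s hmax R Hs B hE j v w hfar hch hlow hcol hh hw0 hiso hw1 hwim hdisc
  have h1 := hL η f x₀ s hmax R Hs B hE j v w hfar hch hlow hcol hh hw0 hiso hw1 hwim hdisc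
  have h2 := hG η f x₀ s hmax R Hs B hE j v w hfar hch hlow hcol hh hw0 hiso hw1 hwim hdisc
  have h3 : (1 + θ) * η / s = η / s + θ * η / s := by ring
  rw [h3]
  linarith

/-- (K) … hence the NAMED SINK as soon as `0 ≤ θ` and `(1+θ)² ≤ 5/4` (`θ ≤ √(5/4) − 1 ≈ 0.118`); with §3 unrestricted: `tModAllowanceBox_of_fLinkBox hL (fLinkBox_of_fLink hG)`. -/
theorem tModAllowanceBox_of_fLinkBox {θ : ℝ} (hL : LineRemainderBoxSig) (hG : FLinkBoxSig' θ) (hθ : 0 ≤ θ) (hθ2 : (1 + θ) ^ 2 ≤ 5 / 4) :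
    TModAllowanceBoxSig :=
  ⟨1 + θ, by linarith, hθ2, farFieldModulusLawBox_of_fLinkBox hL hG⟩

/-- (K) under the box binder the line point lies in the frame's column at EVERY level (the lateral half of the `RemainderBox` box; its height `Im w < Im v ≤ hmax` is the other half). -/
theorem abs_linePt_re_sub_le {v w : ℂ} {x₀ R : ℝ} (hcol : |v.re - x₀| ≤ R / 2) : |(linePt v w).re - x₀| ≤ R / 2 := by
  rw [linePt_re]; exact hcol

/-- ★ (K) **`EngineHyps5 2 … ⇒ §2′ @ j = 0`** — the level-0 instance of `LineRemainderBoxSig`, binder for binder (the box binders are unused: at `j = 0` they are automatic, `abs_re_sub_le_of_stTrkDQ_zero` / `im_le_hmax_of_isLowest_zero`). -/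
theorem lineRemainderBoxSig_zero (η : ℝ) (f : ℂ → ℂ) (x₀ s hmax R Hs : ℝ) (B : ℕ) (hE : EngineHyps5 2 η f x₀ s hmax R Hs B) (v w : ℂ)
    (_hfar : FarLevelQ η f x₀ s hmax R Hs B 0) (_hch : Charged (PTrkSQ PBot) StTrkDQ ReadyR2 η f x₀ s hmax R Hs B 0)
    (hlow : IsLowest StTrkDQ η f x₀ s hmax R Hs B 0 v) (_hcol : |v.re - x₀| ≤ R / 2) (_hh : v.im ≤ hmax) (hw0 : iteratedDeriv 0 f w ≠ 0)
    (hiso : ∀ z : ℂ, iteratedDeriv 0 f z = 0 → |z.re - v.re| < R / 2 → z = v ∨ z = conj v)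
    (_hw1 : iteratedDeriv (0 + 1) f w = 0) (hwim : 0 < w.im) (hdisc : ‖w - (v.re : ℂ)‖ ≤ |v.im|) :
    ‖levelField f 0 (linePt v w)
        - ∑ᶠ u ∈ {u : ℂ | iteratedDeriv 0 f u = 0 ∧ |u.re - v.re| < R / 2},
            ((analyticOrderAt (iteratedDeriv 0 f) u).toNat : ℂ) * (linePt v w - u)⁻¹‖ ≤ η / s :=
  lineRemainder_zero hE hlow hw0 hiso hwim hdisc

/-! ## §6 the LEVEL-`j` BOX REMAINDER SEAM and the TRANSPORT at one (frame, level) ((CA836)(1) named, (CA843)(2) direction (i) curried), PROVED -/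

/-- (seam predicate, HYPOTHESIS-ONLY — asserted for no frame here) the **LEVEL-`j` BOX REMAINDER** `LevelRemainderBox η f x₀ s hmax R j :=
RemainderBox η (iteratedDeriv j f) x₀ s hmax R`: clause 16 of `EngineHyps5` (Seam03 `RemainderBox`) read for the derivative `f⁽ʲ⁾` (at `j = 0` it IS
clause 16, `levelRemainderBox_zero`).  Discharged per (frame, level) by whoever certifies it — an engine-bundle seam of clause-16 standing, a W-08
heredity theorem, or an exact certificate.  It is NOT typed as a law for all frames and levels: v4b's ∀-form `RemainderBoxHereditySig` is withdrawn (crit-1's Gauss–Lucas INFALL rider (CA843)(2);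
C3's own uncertified probes `g52/x3/infall0.py`: on a frame with clause 16 TIGHT at the box edge the box sup creeps up at level 1 by 0.3–0.9 %, and under a
super-critical co-signed tilt swept zeros accumulate beyond the far window edge, +12 % by level 45 — both at levels/points carrying no lowest state). -/
def LevelRemainderBox (η : ℝ) (f : ℂ → ℂ) (x₀ s hmax R : ℝ) (j : ℕ) : Prop := RemainderBox η (iteratedDeriv j f) x₀ s hmax R

/-- (K) at level `0` the seam is the frame's own clause 16. -/
theorem levelRemainderBox_zero {η : ℝ} {f : ℂ → ℂ} {x₀ s hmax R Hs : ℝ} {B : ℕ} (hE : EngineHyps5 2 η f x₀ s hmax R Hs B) :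
    LevelRemainderBox η f x₀ s hmax R 0 := by
  obtain ⟨_, _, _, _, _, _, _, _, _, _, _, _, _, _, _, hRB⟩ := hE
  simpa only [LevelRemainderBox, iteratedDeriv_zero] using hRB

/-- ★ (K, PROVED) **THE LEVEL-`j` TRANSPORT at one (frame, level)**: on a legal frame, GIVEN the level-`j` box remainder seam, for a lowest band state `v`
in the frame's box (crit-1's C′ binder: `|Re v − x₀| ≤ R/2`, `Im v ≤ hmax`) with isolated pair and any non-zero `w` of `f⁽ʲ⁾` in the closed axis-centred
disc with `0 < Im w`, the line point `p₀ = Re v + i·Im w` lies in the box, `f⁽ʲ⁾ p₀ ≠ 0`, and the seam IS the level-`j` line remainder bound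
(`levelField f j = deriv f⁽ʲ⁾ / f⁽ʲ⁾` by `iteratedDeriv_succ`).  The level-`0` argument of `lineRemainder_zero` verbatim with `f ↦ f⁽ʲ⁾`; the HEIGHT half
of C′ feeds `hp2`, the COLUMN half feeds `hp1`. -/
theorem lineRemainderAt_of_levelRemainderBox {η : ℝ} {f : ℂ → ℂ} {x₀ s hmax R Hs : ℝ} {B : ℕ} (hE : EngineHyps5 2 η f x₀ s hmax R Hs B) {j : ℕ}
    {v w : ℂ} (hRB : LevelRemainderBox η f x₀ s hmax R j) (hlow : IsLowest StTrkDQ η f x₀ s hmax R Hs B j v) (hcol : |v.re - x₀| ≤ R / 2)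
    (hh : v.im ≤ hmax) (hw0 : iteratedDeriv j f w ≠ 0) (hiso : ∀ z : ℂ, iteratedDeriv j f z = 0 → |z.re - v.re| < R / 2 → z = v ∨ z = conj v)
    (hwim : 0 < w.im) (hdisc : ‖w - (v.re : ℂ)‖ ≤ |v.im|) :
    ‖levelField f j (linePt v w)
        - ∑ᶠ u ∈ {u : ℂ | iteratedDeriv j f u = 0 ∧ |u.re - v.re| < R / 2},
            ((analyticOrderAt (iteratedDeriv j f) u).toNat : ℂ) * (linePt v w - u)⁻¹‖ ≤ η / s := by
  obtain ⟨_, _, _, hs, hsh, _, h3R, _, _, _, _, _, _, _, _, _⟩ := hE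
  obtain ⟨_, hvz, hvpos, _, _⟩ := hlow.1
  have hR : 0 < R := by linarith
  have hdisc' : ‖w - (v.re : ℂ)‖ ≤ v.im := by rwa [abs_of_pos hvpos] at hdisc
  -- the child's height is strictly below the pair's height
  have hwle : w.im ≤ v.im := by
    have h1 : |(w - (v.re : ℂ)).im| ≤ ‖w - (v.re : ℂ)‖ := Complex.abs_im_le_norm _
    have h2 : (w - (v.re : ℂ)).im = w.im := by simp
    rw [h2, abs_of_pos hwim] at h1
    linarith
  have hwlt : w.im < v.im := by
    rcases lt_or_eq_of_le hwle with h | h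
    · exact h
    · exfalso
      have hn : ‖w - (v.re : ℂ)‖ ^ 2 = (w.re - v.re) ^ 2 + w.im ^ 2 := by
        rw [Complex.sq_norm, Complex.normSq_apply]; simp; ring
      have hd2 : ‖w - (v.re : ℂ)‖ ^ 2 ≤ v.im ^ 2 := pow_le_pow_left₀ (norm_nonneg _) hdisc' 2
      have hre : (w.re - v.re) ^ 2 ≤ 0 := by nlinarith
      have hre0 : w.re - v.re = 0 := pow_eq_zero_iff two_ne_zero |>.mp (le_antisymm hre (sq_nonneg _))
      have hwv : w = v := Complex.ext (by linarith) h
      exact hw0 (by rw [hwv]; exact hvz)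
  -- the line point is in the `RemainderBox` box and is not a zero of `f⁽ʲ⁾`
  have hp1 : |(linePt v w).re - x₀| ≤ R / 2 := by rw [linePt_re]; exact hcol
  have hp2 : |(linePt v w).im| ≤ hmax := by rw [linePt_im, abs_of_pos hwim]; linarith
  have hp3 : iteratedDeriv j f (linePt v w) ≠ 0 := by
    intro hz
    have hwin : |(linePt v w).re - v.re| < R / 2 := by rw [linePt_re, sub_self, abs_zero]; linarith
    rcases hiso _ hz hwin with h | h
    · have h' : (linePt v w).im = v.im := by rw [h]
      rw [linePt_im] at h'
      linarith
    · have h' : (linePt v w).im = (conj v).im := by rw [h]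
      rw [linePt_im, Complex.conj_im] at h'
      linarith
  have key := hRB (linePt v w) hp1 hp2 hp3
  simp only [linePt_re] at key
  simpa only [levelField, iteratedDeriv_succ] using key

/-! ## §7 the PLUMBED twin of the modulus law (C′ binder, then the seam `LevelRemainderBox … j` as ONE hypothesis): the gain law ALONE gives the sink, PROVED -/

/-- (T, OPEN modulo the seam) **FAR-FIELD MODULUS LAW, BOX-BINDERED AND PLUMBED** `FarFieldModulusLawBoxPl lam`: the tree's T-MOD′ `FarFieldModulusLawA' lam`
with crit-1's box binder and then the level-`j` seam `LevelRemainderBox η f x₀ s hmax R j` as ONE hypothesis (direction (i): the per-level box is plumbed, not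
asserted).  PROVED below from the gain law alone at `λ = 1 + θ`. -/
def FarFieldModulusLawBoxPl (lam : ℝ) : Prop :=
  ∀ (η : ℝ) (f : ℂ → ℂ) (x₀ s hmax R Hs : ℝ) (B : ℕ), EngineHyps5 2 η f x₀ s hmax R Hs B →
    ∀ (j : ℕ) (v w : ℂ), FarLevelQ η f x₀ s hmax R Hs B j → Charged (PTrkSQ PBot) StTrkDQ ReadyR2 η f x₀ s hmax R Hs B j →
      IsLowest StTrkDQ η f x₀ s hmax R Hs B j v → |v.re - x₀| ≤ R / 2 → v.im ≤ hmax → LevelRemainderBox η f x₀ s hmax R j →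
      iteratedDeriv j f w ≠ 0 → (∀ z : ℂ, iteratedDeriv j f z = 0 → |z.re - v.re| < R / 2 → z = v ∨ z = conj v) →
      iteratedDeriv (j + 1) f w = 0 → 0 < w.im → ‖w - (v.re : ℂ)‖ ≤ |v.im| → ‖farFieldAt f j v w‖ ≤ lam * η / s

/-- (T) **THE SINK, NAMED (plumbed)**: the box-bindered plumbed modulus law holds with SOME multiplier inside the sharp step's allowance `λ² ≤ 5/4`. -/
def TModAllowanceBoxPlSig : Prop := ∃ lam : ℝ, 0 < lam ∧ lam ^ 2 ≤ 5 / 4 ∧ FarFieldModulusLawBoxPl lam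

/-- (K) the box-bindered modulus law implies its plumbed twin (drop the seam hypothesis). -/
theorem farFieldModulusLawBoxPl_of_lawBox (lam : ℝ) (h : FarFieldModulusLawBox lam) : FarFieldModulusLawBoxPl lam :=
  fun η f x₀ s hmax R Hs B hE j v w hfar hch hlow hcol hh _hRB hw0 hiso hw1 hwim hdisc =>
    h η f x₀ s hmax R Hs B hE j v w hfar hch hlow hcol hh hw0 hiso hw1 hwim hdisc

/-- (K) the tree's T-MOD′ implies the plumbed box form (drop three binders; bookkeeping — T-MOD′ is candidate-dead as typed on X3). -/
theorem farFieldModulusLawBoxPl_of_lawA' (lam : ℝ) (h : FarFieldModulusLawA' lam) : FarFieldModulusLawBoxPl lam :=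
  fun η f x₀ s hmax R Hs B hE j v w hfar hch hlow _hcol _hh _hRB hw0 hiso hw1 hwim hdisc =>
    h η f x₀ s hmax R Hs B hE j v w hfar hch hlow hw0 hiso hw1 hwim hdisc

/-- ★ (K, PROVED) **THE GAIN LAW ALONE GIVES THE PLUMBED BOX MODULUS LAW at `λ = 1 + θ`**: the seam hypothesis is transported to the line point by
`lineRemainderAt_of_levelRemainderBox`, and §3′ is the triangle's other leg.  OPEN content left: the gain law (and, per frame, the seam). -/
theorem farFieldModulusLawBoxPl_of_fLinkBox {θ : ℝ} (hG : FLinkBoxSig' θ) : FarFieldModulusLawBoxPl (1 + θ) := by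
  intro η f x₀ s hmax R Hs B hE j v w hfar hch hlow hcol hh hRB hw0 hiso hw1 hwim hdisc
  have h1 := lineRemainderAt_of_levelRemainderBox hE hRB hlow hcol hh hw0 hiso hwim hdisc
  have h2 := hG η f x₀ s hmax R Hs B hE j v w hfar hch hlow hcol hh hw0 hiso hw1 hwim hdisc
  have h3 : (1 + θ) * η / s = η / s + θ * η / s := by ring
  rw [h3]
  linarith

/-- (K) … hence the NAMED SINK from the gain law alone, as soon as `0 ≤ θ` and `(1+θ)² ≤ 5/4` (`θ ≤ √(5/4) − 1 ≈ 0.118`). -/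
theorem tModAllowanceBoxPl_of_fLinkBox {θ : ℝ} (hG : FLinkBoxSig' θ) (hθ : 0 ≤ θ) (hθ2 : (1 + θ) ^ 2 ≤ 5 / 4) : TModAllowanceBoxPlSig :=
  ⟨1 + θ, by linarith, hθ2, farFieldModulusLawBoxPl_of_fLinkBox hG⟩

/-- (K) idem from the UNRESTRICTED gain law §3. -/
theorem tModAllowanceBoxPl_of_fLink {θ : ℝ} (hG : FLinkSig' θ) (hθ : 0 ≤ θ) (hθ2 : (1 + θ) ^ 2 ≤ 5 / 4) : TModAllowanceBoxPlSig :=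
  tModAllowanceBoxPl_of_fLinkBox (fLinkBox_of_fLink hG) hθ hθ2

end RhW08.FLink

end
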